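import Mathlib
import Summits.Ventures.LatticeQCDFlow.TrivializingMaps.ZeroModes
import Summits.Ventures.LatticeQCDFlow.TrivializingMaps.PlaquetteData
import Summits.Ventures.LatticeQCDFlow.TrivializingMaps.SlotHilbert

/-!
# Rank-one coefficient functions: the data of the graded Lüscher series (THEORY-1 §19.3, file (5c-ii))

HONEST FRAMING. Exact (Metropolis-corrected) sampling algorithms for lattice gauge theory; figures of
merit are autocorrelation/cost numbers at stated couplings and volumes; no continuum-physics claim.
This file is finite-dimensional linear algebra plus the tree's link-derivative conventions; no physics.

A DATUM of the Casimir-graded construction of Lüscher's flow-action series is a slot system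
`(lnk, pol)` on `σ`, two vectors `x y ∈ ℓ²(σ → Fin n)` and a coefficient `z ∈ ℂ`; its FUNCTION is
`termF lnk pol z x y : W ↦ Re (z · ⟪y, R_σ(W) x⟫)` — in the tree's kernel language
`coeff lnk pol (z • |x⟩⟨y|)` (`termF`, `termF_apply`, `coeffC_rank1`).  Proved here, in the tree's
conventions `Luscher2010.linkDeriv` / `Luscher2010.linkLap`:

* `linkDeriv_termF_skew` : `∂_{e,Y} termF(z,x,y) = - termF(z, x, T^{σ,e}_Y y)` (`Y` skew) — derivatives act
  on the BRA vector, everywhere on the ambient space;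
* `linkLap_termF_jointProj` : for `y = P_m v` in the joint Casimir mode `m`,
  `Δ termF(z,x,y) = c(m) · termF(z,x,y)` EVERYWHERE, `c(m) = ∑ₑ mₑ` (`modeC`);
* `abs_termF_coeConfig_le` : `|termF(z,x,y)(ιU)| ≤ |z| ‖x‖ ‖y‖` on `SU(n)^E` (the MASS of the datum);
* `abs_linkDeriv_termF_coeConfig_le` : `|∂^a_e termF(z,x,P_m v)(ιU)| ≤ |z| ‖x‖ √(mₑ) ‖P_m v‖` (E2: a link
  derivative costs `√(mₑ)`, NOT the ambient dimension);
* `termF_coeConfig_eq_of_mode_zero` : a datum in the zero joint mode is constant on `SU(n)^E` (all its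
  basis link derivatives vanish identically; `ZeroModes.apply_coeConfig_eq_of_linkDeriv_eq_zero`).
[ours (bookkeeping); every ingredient folklore]
-/

noncomputable section

namespace Summit.Ventures.LatticeQCDFlow.TrivializingMaps.RankOne

open scoped ComplexConjugate Matrix Matrix.Norms.Frobenius InnerProductSpace ContDiff
open Finset
open Literature.MathematicalPhysics.QuantumFieldTheory
open Literature.MathematicalPhysics.QuantumFieldTheory.Luscher2010
open SlotRepresentation SlotCasimir SlotCoefficient SlotHilbert JointGrading CasimirGrading PlaquetteData

variable {n : ℕ} {σ : Type*} [Fintype σ] [DecidableEq σ]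

/-! ## 1. Rank-one kernels -/

/-- The rank-one kernel `|x⟩⟨y|`: `(I, J) ↦ conj(y_I) · x_J`. [folklore] -/
def rank1 (x y : SlotSpace σ n) : Kernel σ n := fun I J => conj (WithLp.ofLp y I) * WithLp.ofLp x J

/-- Entries of `rank1`. [folklore] -/
@[simp] theorem rank1_apply (x y : SlotSpace σ n) (I J : σ → Fin n) :
    rank1 x y I J = conj (WithLp.ofLp y I) * WithLp.ofLp x J := rfl

/-- `⟪y, R x⟫ = ∑_{I,J} conj(y_I) x_J R_{IJ}`. [folklore] -/
theorem inner_toE (y x : SlotSpace σ n) (R : Matrix (σ → Fin n) (σ → Fin n) ℂ) :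
    ⟪y, toE R x⟫_ℂ = ∑ I, ∑ J, rank1 x y I J * R I J := by
  simp only [PiLp.inner_apply, RCLike.inner_apply, Matrix.ofLp_toEuclideanCLM, Matrix.mulVec,
    dotProduct, Finset.sum_mul, rank1_apply]
  exact Finset.sum_congr rfl fun I _ => Finset.sum_congr rfl fun J _ => by ring

/-- `|x⟩⟨y|` with `y = 0` is `0`. [folklore] -/
@[simp] theorem rank1_zero_right (x : SlotSpace σ n) : rank1 x (0 : SlotSpace σ n) = 0 := by
  funext I J; simp

/-- `|x⟩⟨-y| = -|x⟩⟨y|`. [folklore] -/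
theorem rank1_neg_right (x y : SlotSpace σ n) : rank1 x (-y) = -rank1 x y := by
  funext I J; simp [neg_mul]

/-- `|x⟩⟨c y| = conj(c) |x⟩⟨y|`. [folklore] -/
theorem rank1_smul_right (c : ℂ) (x y : SlotSpace σ n) : rank1 x (c • y) = conj c • rank1 x y := by
  funext I J; simp [mul_assoc]

/-- Contraction acts on the bra vector by the adjoint: `|x⟩⟨y| ⋆ G = |x⟩⟨Gᴴ y|`. [folklore] -/
theorem contract_rank1 (x y : SlotSpace σ n) (G : Matrix (σ → Fin n) (σ → Fin n) ℂ) :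
    contract (rank1 x y) G = rank1 x (toE Gᴴ y) := by
  funext K J
  simp only [contract, rank1_apply, Matrix.ofLp_toEuclideanCLM, Matrix.mulVec, dotProduct,
    Matrix.conjTranspose_apply, map_sum, map_mul, Complex.star_def, starRingEnd_self_apply,
    Finset.sum_mul]
  exact Finset.sum_congr rfl fun I _ => by ring

/-- Scalars pass through contraction. [folklore] -/
theorem contract_smul (z : ℂ) (a : Kernel σ n) (G : Matrix (σ → Fin n) (σ → Fin n) ℂ) :
    contract (z • a) G = z • contract a G := by
  funext K J; simp only [contract, Pi.smul_apply, smul_eq_mul, Finset.mul_sum, mul_assoc]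

variable {d L : ℕ}

/-- Scalars pass through the complex coefficient function. [folklore] -/
theorem coeffC_smul (lnk : σ → Edge d L) (pol : σ → Bool) (z : ℂ) (a : Kernel σ n)
    (W : AmbConfig d L n) : coeffC lnk pol (z • a) W = z * coeffC lnk pol a W := by
  simp only [coeffC, Pi.smul_apply, smul_eq_mul, Finset.mul_sum, mul_assoc]

/-- The zero kernel has zero coefficient function. [folklore] -/
@[simp] theorem coeffC_zero (lnk : σ → Edge d L) (pol : σ → Bool) (W : AmbConfig d L n) :
    coeffC lnk pol (0 : Kernel σ n) W = 0 := by
  simp [coeffC]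

/-- **Rank-one coefficient functions are matrix coefficients**: `coeffC(|x⟩⟨y|)(W) = ⟪y, R_σ(W) x⟫`.
[folklore] -/
theorem coeffC_rank1 (lnk : σ → Edge d L) (pol : σ → Bool) (x y : SlotSpace σ n)
    (W : AmbConfig d L n) : coeffC lnk pol (rank1 x y) W = ⟪y, repCLM lnk pol W x⟫_ℂ := by
  rw [coeffC]; exact (inner_toE y x _).symm

/-! ## 2. The function of a datum and its link derivatives -/

section Term
variable (lnk : σ → Edge d L) (pol : σ → Bool) (z : ℂ) (x : SlotSpace σ n)

/-- The FUNCTION of the datum `(lnk, pol, z, x, y)`: `W ↦ Re (z ⟪y, R_σ(W) x⟫)`, as the tree-convention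
coefficient function of the kernel `z • |x⟩⟨y|`. [ours] -/
def termF (y : SlotSpace σ n) : AmbConfig d L n → ℝ := coeff lnk pol (z • rank1 x y)

/-- `termF` evaluated. [ours] -/
theorem termF_apply (y : SlotSpace σ n) (W : AmbConfig d L n) :
    termF lnk pol z x y W = (z * ⟪y, repCLM lnk pol W x⟫_ℂ).re := by
  show (coeffC lnk pol (z • rank1 x y) W).re = _
  rw [coeffC_smul, coeffC_rank1]

/-- `termF` with zero bra vector vanishes. [ours] -/
@[simp] theorem termF_zero_right (W : AmbConfig d L n) : termF lnk pol z x 0 W = 0 := by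
  show (coeffC lnk pol (z • rank1 x 0) W).re = 0
  rw [rank1_zero_right, smul_zero, coeffC_zero, Complex.zero_re]

/-- `termF` is odd in the bra vector. [ours] -/
theorem termF_neg_right (y : SlotSpace σ n) (W : AmbConfig d L n) :
    termF lnk pol z x (-y) W = -termF lnk pol z x y W := by
  show (coeffC lnk pol (z • rank1 x (-y)) W).re = -(coeffC lnk pol (z • rank1 x y) W).re
  rw [rank1_neg_right, smul_neg, coeffC_neg, Complex.neg_re]

/-- Real scalars on the bra vector come out. [ours] -/
theorem termF_smul_real_right (r : ℝ) (y : SlotSpace σ n) (W : AmbConfig d L n) :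
    termF lnk pol z x ((r : ℂ) • y) W = r * termF lnk pol z x y W := by
  show (coeffC lnk pol (z • rank1 x ((r : ℂ) • y)) W).re = r * (coeffC lnk pol (z • rank1 x y) W).re
  rw [rank1_smul_right, Complex.conj_ofReal, smul_comm, coeffC_smul, Complex.re_ofReal_mul]

/-- The function of a datum is smooth. [ours] -/
theorem contDiff_termF [NeZero L] (y : SlotSpace σ n) : ContDiff ℝ ∞ (termF lnk pol z x y) :=
  contDiff_coeff lnk pol (z • rank1 x y)

/-- **Link derivative of a datum** (tree convention): `∂_{e,Y} termF(z,x,y) = termF(z,x,(T^{σ,e}_Y)ᴴ y)`,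
identically on the ambient space. [ours] -/
theorem linkDeriv_termF (y : SlotSpace σ n) (e : Edge d L) (Y : Matrix (Fin n) (Fin n) ℂ)
    (W : AmbConfig d L n) :
    linkDeriv e Y (termF lnk pol z x y) W = termF lnk pol z x (toE (slotGen lnk pol e Y)ᴴ y) W := by
  rw [termF, linkDeriv_coeff, contract_smul, contract_rank1]; rfl

/-- **Link derivative of a datum, skew direction**: `∂_{e,Y} termF(z,x,y) = -termF(z,x,T^{σ,e}_Y y)`.
[ours] -/
theorem linkDeriv_termF_skew (y : SlotSpace σ n) (e : Edge d L) {Y : Matrix (Fin n) (Fin n) ℂ}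
    (hY : Yᴴ = -Y) (W : AmbConfig d L n) :
    linkDeriv e Y (termF lnk pol z x y) W = -termF lnk pol z x (genCLM lnk pol e Y y) W := by
  rw [linkDeriv_termF, slotGen_conjTranspose_of_skew lnk pol e hY, toE_neg]
  exact termF_neg_right lnk pol z x _ W

/-- **Lüscher's Laplacian of a datum**: `Δ termF(z,x,y) = termF(z,x,(∑ₑ C^{σ,e}) y)`, identically on the
ambient space. [ours] -/
theorem linkLap_termF [NeZero L] (B : SuBasis n) (y : SlotSpace σ n) (W : AmbConfig d L n) :
    linkLap B (termF lnk pol z x y) W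
      = termF lnk pol z x ((∑ e : Edge d L, casimirCLM lnk pol B e) y) W := by
  rw [termF, linkLap_coeff, contract_smul, contract_rank1, Matrix.conjTranspose_sum]
  simp only [casimirM_conjTranspose]
  rw [toE_sum]; rfl

end Term

/-! ## 3. Data in a joint Casimir mode -/

section Mode
variable (lnk : σ → Edge d L) (pol : σ → Bool) (B : SuBasis n)

/-- The eigenvalue of `Δ` on the joint mode `m`: `c(m) = ∑ₑ mₑ`. [ours] -/
def modeC [NeZero L] (m : Modes (casimirFamily lnk pol B)) : ℝ := ∑ e : Edge d L, (m e : ℂ).re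

/-- `c(m) ≥ 0`. [ours] -/
theorem modeC_nonneg [NeZero L] (m : Modes (casimirFamily lnk pol B)) : 0 ≤ modeC lnk pol B m :=
  Finset.sum_nonneg fun e _ => slotMode_nonneg lnk pol B m e

/-- `(∑ₑ C^{σ,e}) P_m v = c(m) P_m v`. [ours] -/
theorem sum_casimirCLM_jointProj [NeZero L] (m : Modes (casimirFamily lnk pol B)) (v : SlotSpace σ n) :
    (∑ e : Edge d L, casimirCLM lnk pol B e) (jointProj (casimirFamily lnk pol B) m v)
      = ((modeC lnk pol B m : ℝ) : ℂ) • jointProj (casimirFamily lnk pol B) m v := by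
  rw [_root_.sum_apply]
  simp_rw [casimirCLM_jointProj]
  rw [← Finset.sum_smul, modeC, Complex.ofReal_sum]

variable (z : ℂ) (x : SlotSpace σ n)

/-- **Eigen-equation of a graded datum**: for `y = P_m v`, `Δ termF(z,x,y) = c(m) · termF(z,x,y)`
IDENTICALLY on the ambient space (not only on `SU(n)^E`). [ours] -/
theorem linkLap_termF_jointProj [NeZero L] (m : Modes (casimirFamily lnk pol B)) (v : SlotSpace σ n)
    (W : AmbConfig d L n) :
    linkLap B (termF lnk pol z x (jointProj (casimirFamily lnk pol B) m v)) W
      = modeC lnk pol B m * termF lnk pol z x (jointProj (casimirFamily lnk pol B) m v) W := by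
  rw [linkLap_termF, sum_casimirCLM_jointProj, termF_smul_real_right]

/-- In a mode with `mₑ = 0` the generators on the link `e` kill `P_m v`. [ours] -/
theorem genCLM_jointProj_eq_zero (m : Modes (casimirFamily lnk pol B)) (e : Edge d L) (a : B.ι)
    (v : SlotSpace σ n) (h0 : (m e : ℂ).re = 0) :
    genCLM lnk pol e (B.T a) (jointProj (casimirFamily lnk pol B) m v) = 0 := by
  have h := norm_genCLM_jointProj_le lnk pol B m e a v
  rw [h0, Real.sqrt_zero, zero_mul] at h
  exact norm_le_zero_iff.1 h

/-- In a mode with `mₑ = 0` the basis link derivatives at `e` of the datum vanish identically. [ours] -/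
theorem linkDeriv_termF_eq_zero_of_mode_zero (m : Modes (casimirFamily lnk pol B)) (v : SlotSpace σ n)
    {e : Edge d L} (h0 : (m e : ℂ).re = 0) (a : B.ι) (W : AmbConfig d L n) :
    linkDeriv e (B.T a) (termF lnk pol z x (jointProj (casimirFamily lnk pol B) m v)) W = 0 := by
  rw [linkDeriv_termF_skew lnk pol z x _ e (skew_T B a), genCLM_jointProj_eq_zero lnk pol B m e a v h0,
    termF_zero_right, neg_zero]

/-- **Zero-mode data are constant on the field manifold** `SU(n)^E`. [ours] -/
theorem termF_coeConfig_eq_of_mode_zero [NeZero L] (m : Modes (casimirFamily lnk pol B))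
    (v : SlotSpace σ n) (h0 : ∀ e, (m e : ℂ).re = 0)
    (U : GaugeConfig d L (Matrix.specialUnitaryGroup (Fin n) ℂ)) :
    termF lnk pol z x (jointProj (casimirFamily lnk pol B) m v) (WilsonFlow.coeConfig U)
      = termF lnk pol z x (jointProj (casimirFamily lnk pol B) m v) (WilsonFlow.coeConfig fun _ => 1) :=
  apply_coeConfig_eq_of_linkDeriv_eq_zero B ((contDiff_termF lnk pol z x _).differentiable (by simp))
    (fun e a U' => linkDeriv_termF_eq_zero_of_mode_zero lnk pol B z x m v (h0 e) a _) U

end Mode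

/-! ## 4. Masses: bounds on the field manifold -/

section Mass
variable (lnk : σ → Edge d L) (pol : σ → Bool) (z : ℂ) (x : SlotSpace σ n)

/-- Links of an `SU(n)` configuration are unitary. [folklore] -/
theorem coeConfig_mem_unitaryGroup (U : GaugeConfig d L (Matrix.specialUnitaryGroup (Fin n) ℂ))
    (e : Edge d L) : WilsonFlow.coeConfig U e ∈ Matrix.unitaryGroup (Fin n) ℂ :=
  (Matrix.mem_specialUnitaryGroup_iff.1 (U e).2).1

/-- **The mass bounds the datum on `SU(n)^E`**: `|termF(z,x,y)(ιU)| ≤ |z| ‖x‖ ‖y‖`. [ours] -/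
theorem abs_termF_coeConfig_le (y : SlotSpace σ n)
    (U : GaugeConfig d L (Matrix.specialUnitaryGroup (Fin n) ℂ)) :
    |termF lnk pol z x y (WilsonFlow.coeConfig U)| ≤ ‖z‖ * ‖x‖ * ‖y‖ := by
  rw [termF_apply]
  refine (Complex.abs_re_le_norm _).trans ?_
  rw [norm_mul]
  have h1 : ‖⟪y, repCLM lnk pol (WilsonFlow.coeConfig U) x⟫_ℂ‖ ≤ ‖y‖ * ‖x‖ := by
    refine (norm_inner_le_norm y _).trans ?_
    rw [norm_repCLM_apply lnk pol (coeConfig_mem_unitaryGroup U)]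
  calc ‖z‖ * ‖⟪y, repCLM lnk pol (WilsonFlow.coeConfig U) x⟫_ℂ‖ ≤ ‖z‖ * (‖y‖ * ‖x‖) :=
        mul_le_mul_of_nonneg_left h1 (norm_nonneg z)
    _ = ‖z‖ * ‖x‖ * ‖y‖ := by ring

variable (B : SuBasis n)

/-- **(E2) a link derivative costs `√(mₑ)`**: for `y = P_m v`,
`|∂^a_e termF(z,x,y)(ιU)| ≤ |z| ‖x‖ √(mₑ) ‖y‖`. [ours] -/
theorem abs_linkDeriv_termF_coeConfig_le (m : Modes (casimirFamily lnk pol B)) (v : SlotSpace σ n)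
    (e : Edge d L) (a : B.ι) (U : GaugeConfig d L (Matrix.specialUnitaryGroup (Fin n) ℂ)) :
    |linkDeriv e (B.T a) (termF lnk pol z x (jointProj (casimirFamily lnk pol B) m v))
        (WilsonFlow.coeConfig U)|
      ≤ ‖z‖ * ‖x‖ * (Real.sqrt (m e : ℂ).re * ‖jointProj (casimirFamily lnk pol B) m v‖) := by
  rw [linkDeriv_termF_skew lnk pol z x _ e (skew_T B a), abs_neg]
  refine (abs_termF_coeConfig_le lnk pol z x _ U).trans ?_
  exact mul_le_mul_of_nonneg_left (norm_genCLM_jointProj_le lnk pol B m e a v) (by positivity)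

/-- (E6b) generators preserve every joint Casimir space: `y ∈ H_m ⇒ T^{σ,e}_Y y ∈ H_m` (`Y ∈ 𝔰𝔲(n)`).
[ours] -/
theorem genCLM_mem_jointSpace [DecidableEq (Edge d L)] (m : Modes (casimirFamily lnk pol B)) (e : Edge d L)
    {Y : Matrix (Fin n) (Fin n) ℂ} (hY : Y ∈ suAlgebra n) {y : SlotSpace σ n}
    (hy : y ∈ jointSpace (casimirFamily lnk pol B) m) :
    genCLM lnk pol e Y y ∈ jointSpace (casimirFamily lnk pol B) m := by
  rw [mem_jointSpace_iff] at hy ⊢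
  intro e'
  have h := congrArg (fun F : SlotSpace σ n →L[ℂ] SlotSpace σ n => F y)
    (genCLM_comm_casimirCLM lnk pol B e' e hY)
  simp only [ContinuousLinearMap.comp_apply] at h
  show casimirCLM lnk pol B e' (genCLM lnk pol e Y y) = _
  rw [← h, show casimirCLM lnk pol B e' y = (m e' : ℂ) • y from hy e', map_smul]

/-- A member of the joint space is its own projection: `y ∈ H_m ⇒ P_m y = y`. [folklore] -/
theorem jointProj_eq_self_of_mem {E' H : Type*} [NormedAddCommGroup H] [InnerProductSpace ℂ H]
    [FiniteDimensional ℂ H] {C : E' → H →L[ℂ] H} (m : Modes C) {v : H} (hv : v ∈ jointSpace C m) :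
    jointProj C m v = v := by
  unfold jointProj
  exact Submodule.starProjection_eq_self_iff.2 hv

end Mass

end Summit.Ventures.LatticeQCDFlow.TrivializingMaps.RankOne
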